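import Literature.MathematicalPhysics.QuantumFieldTheory.Balaban1983to89.B12Eq531Symmetry
import Literature.Analysis.Complex.HolomorphicParametricIntegral

/-!
# `Balaban1983to89.B12Taylor530` — T. Bałaban, *Renormalization group approach to lattice gauge field theories. I*,
Commun. Math. Phys. **109** (1987) 249–301 [Balaban1987RG1]: the third-order Taylor formula (5.30) p. 295 WITH INTEGRAL
REMAINDER for the functions `g_{μν}(z)` around `z = 1` — PROVED (for every function holomorphic on an open set containing
the segment `1 + t(z − 1)`, and for the paper's `g_{μν}` on the polydisc `×_μ{|z_μ| < e^{δ₁}}`)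

statement-level skeleton of published theorems with citation tags; proofs where landed; nothing here is a claim about the Yang–Mills mass gap

PDF held: `paper:balaban1987-cmp109-rg-i-small-field` (journal page = PDF page + 248; p. 295 [PDF 47] read as an image from the
page renders `b2b-balaban-ref1/pages/1987-cmp109-rg-I-small-field/…-p047-x2.png`, `…-p047-x4.png`).

CITATION HEADER / WHAT IS REPRODUCED.  SKELETON row `B12.Eq5.30-5.32` of the cell `lit-balaban` (HOME
`run/shared/lean/pub/lit-balaban/`, reader file `lit-balaban-r09/ROWS-B12.md`): its member (5.30) was `typed-existing` as
the JETS of `B12Sec5Algebra` (`T2`, `taylor₂`: the Taylor data as a structure); (5.31)/(5.32) are `B12Eq531Symmetry`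
(p247903).  This file proves the FORMULA (5.30) itself: the second-order Taylor expansion with the third-order integral
remainder along the segment from `1` to `z`, in the printed coordinates (`∂/∂z_κ` = `B12Momentum511.pderiv`, `a_{μν,κ}` =
`B12Eq531Symmetry.coeffA`, `b_{μν,κλ}` = `coeffB`), together with both printed clauses after the display (reality for real
`z`; analyticity of the remainder functions on the polydisc).  Tools, all BY NAME: the tree's several-complex-variables calculus
`Literature.Analysis.Complex.SCV` (`hasDerivAt_slice`, `differentiableOn_iterate_fderiv_apply`,
`differentiableOn_fderiv_apply`, `analyticOnNhd_of_differentiableOn`), holomorphy of dominated parameter integrals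
(`Literature.Analysis.Complex.differentiableOn_integral_of_dominated`), the analyticity of the paper's `g_{μν}` on the
polydisc (`B12Rep526Analytic.analyticOnNhd_gRep`), Mathlib's fundamental theorem of calculus
(`intervalIntegral.integral_eq_sub_of_hasDerivAt`).  Unit `lit-balaban-r09` gen 5.

WHAT IS PRINTED (p. 295 [PDF 47], verbatim).  *"The first step to get (5.16) is to expand the functions g_{μν}(z) up to the
third order around the point (1,…,1) = 1,
g_{μν}(z) = g_{μν}(1) + Σ_κ(z_κ − 1)(∂/∂z_κ g_{μν})(1) + ½Σ_{κ,λ}(z_κ − 1)(z_λ − 1)(∂²/∂z_κ∂z_λ g_{μν})(1)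
  + Σ_{κ,λ,ρ}(z_κ − 1)(z_λ − 1)(z_ρ − 1) ½∫₀¹dt (1 − t)² (∂³/∂z_κ∂z_λ∂z_ρ g_{μν})(1 + t(z − 1))
  = g_{μν}(1) + Σ_κ a_{μν,κ}(z_κ − 1) + ½Σ_{κ,λ} b_{μν,κλ}(z_κ − 1)(z_λ − 1) + Σ_{κ,λ,ρ} g_{μν,κλρ}(z)(z_κ − 1)(z_λ − 1)(z_ρ − 1). (5.30)
The coefficients a, b and the functions g above are real for real values of z, the functions are analytic on the polydisc
×_μ{|z_μ| < e^{δ₁}}."*  READING NOTE: the weight of the integral remainder is the standard `(1 − t)²/2` of the second-order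
Taylor formula (the exponent of `(1 − t)` is at the limit of legibility on the held scan; the weight `½(1 − t)²` is the
one for which the display is an identity, and is the one proved here).

WHAT IS PROVED (kernel-checked; any `d`).
* §1 the dictionary between the printed partial derivatives and Fréchet derivatives: `pderiv_eq_fderiv`
  (`∂_κf(ζ) = Df(ζ)e_κ`), `fderiv_apply_eq_sum_pderiv` (`Df(ζ)v = Σ_κ v_κ∂_κf(ζ)`), `pderiv_congr_of_eqOn` (locality),
  `differentiableOn_pderiv` (partials of holomorphic functions are holomorphic, via `SCV.differentiableOn_fderiv_apply`),
  `pderiv_sum_mul` (linearity).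
* §2 **the second-order Taylor formula with integral remainder along a complex segment** `taylor2_segment`: for `f`
  holomorphic on an open `U ⊇ {x + tv : t ∈ [0,1]}`,
  `f(x + v) = f(x) + (D_vf)(x) + ½(D_v²f)(x) + ∫₀¹ ½(1 − t)²(D_v³f)(x + tv)dt`, `D_v^k f = (fderiv ℂ · · v)^[k] f`
  (FTC for `H(t) = f + (1 − t)D_vf + ½(1 − t)²D_v²f` along the segment).  The tree's real-`C³`/`C⁵` siblings
  `B14Eq369ThirdOrder.taylor3_integral_remainder`, `B12Taylor334.taylor334` (Mathlib `taylor_integral_remainder`,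
  `iteratedDerivWithin ℝ`) are not used: the data here is a HOLOMORPHIC `f` on an open subset of `ℂ^d` and the printed
  coordinates are complex partials, so the formula is proved directly with `D_v^kf = (fderiv ℂ · · v)^[k]f`.
* §3 coordinates: `iter_one_apply`, `iter_two_apply`, `iter_three_apply` — on `U`, `D_vf = Σ_κv_κ∂_κf`,
  `D_v²f = Σ_{κ,λ}v_κv_λ∂_κ∂_λf`, `D_v³f = Σ_{κ,λ,ρ}v_κv_λv_ρ∂_κ∂_λ∂_ρf`.
* §4 **(5.30)** `eq530` for ANY `g` holomorphic on the open polydisc `×_μ{|z_μ| < e^{a}}`, `a > 0`, and every `z` there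
  (the polydisc is convex and contains `1`): `g(z) = g(1) + Σ_κ(z_κ − 1)(∂_κg)(1) + ½Σ_{κ,λ}(z_κ − 1)(z_λ − 1)(∂_κ∂_λg)(1)
  + Σ_{κ,λ,ρ}(z_κ − 1)(z_λ − 1)(z_ρ − 1)·g_{κλρ}(z)`, `g_{κλρ}(z) = ∫₀¹ ½(1 − t)²(∂_κ∂_λ∂_ρg)(1 + t(z − 1))dt` (`rem530`); and
  **`eq530_gRep`** for the paper's `g_{μν}` = `B12Rep526Coeff.gRep c μ ν` under the (5.10)-type bound `ExpBound a M (c μ ν)`,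
  with `a_{μν,κ} = coeffA`, `b_{μν,κλ} = coeffB` of `B12Eq531Symmetry`.
* §5 **«the functions are analytic on the polydisc»**: `differentiableOn_rem530` / `analyticOnNhd_rem530` — the remainder
  functions `g_{κλρ} = rem530 g κ λ ρ` are holomorphic, hence analytic, on the polydisc whenever `g` is (a parameter integral
  over `t ∈ [0,1]` of the holomorphic family `z ↦ ½(1 − t)²(∂³g)(1 + t(z − 1))`, dominated on small balls by the bound of
  `∂³g` on a compact sub-region: the tree's `Literature.Analysis.Complex.differentiableOn_integral_of_dominated` and
  `SCV.analyticOnNhd_of_differentiableOn`, BY NAME); `analyticOnNhd_rem530_gRep` for the paper's `g_{μν}`.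
* §6 (v1.1) **«The coefficients a, b and the functions g above are real for real values of z»**: `im_pderiv_eq_zero`
  (partials of a holomorphic function real at the real points of an open `U` are real at real points: the derivative
  along the REAL coordinate line of a real function), iterated `im_pderiv_pderiv_eq_zero`/`im_pderiv_pderiv_pderiv_eq_zero`,
  `im_rem530_eq_zero` (the remainders at real points of the polydisc: a real integrand on `[0,1]`); for the paper's
  `g_{μν}` with a REAL kernel (`B12Rep526Coeff.castK`, reality of `g_{μν}` = `B12Rep526Coeff.gRep_im_eq_zero`):
  `im_coeffA_gRep_eq_zero`, `im_coeffB_gRep_eq_zero`, `im_rem530_gRep_eq_zero`.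
No `Prop` placeholder; axioms standard.  v1.1 = v1.0 (p248424: §§1–5) + §6, append-only.

v1.2 (unit `lit-balaban-r09` gen 10, 2026-08-21; APPEND-ONLY new § 7, no v1.1 declaration changed): KERNEL WITNESS for
the READING NOTE above, asked for by the referee (ref-5 REFEREE-P2 gen 9, ask L-g9 (a): «B12.Eq5.30 remainder weight
«(1 − t)» on the render vs the proved «(1 − t)²» — r09's READING NOTE deserves a GAPS print-slip row»; GAPS G-B12-04):
re-read on the x2 render `…-p047-x2.png` (this seat, 2026-08-21) the weight of the integral remainder in (5.30) prints as
«½∫₀¹dt(1 − t)», with NO visible square.  § 7 shows on the one-variable cubic `(z − 1)³` (expanded at `1`, evaluated at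
`z = 2`) that the display with the literal weight `(1 − t)` is FALSE (`weight_one_fails`: the right side is `3/2 ≠ 1`)
while the weight `(1 − t)²` proved in §§ 2–4 makes it an identity (`weight_two_holds`); a harmless print slip
(or a lost superscript of the scan), located, nothing of the paper affected — (5.30) is used only through the
analyticity and reality of its terms.
-/

namespace Literature.MathematicalPhysics.QuantumFieldTheory.Balaban1983to89.B12Taylor530

noncomputable section

open Complex MeasureTheory intervalIntegral
open scoped Real Topology
open Literature.Analysis.Complex.SCV (hasDerivAt_slice hasDerivAt_slice_zero differentiableOn_iterate_fderiv_apply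
  differentiableOn_fderiv_apply analyticOnNhd_of_differentiableOn)
open Literature.Analysis.Complex (differentiableOn_integral_of_dominated)
open Literature.MathematicalPhysics.QuantumFieldTheory.GawedzkiKupiainen1985.PeriodicGleason (Pt ExpBound)
open Literature.MathematicalPhysics.QuantumFieldTheory.Balaban1983to89.B12Rep526Coeff (gRep castK gRep_im_eq_zero)
open Literature.MathematicalPhysics.QuantumFieldTheory.Balaban1983to89.B12Rep526Analytic (OpenPolyDisc isOpen_openPolyDisc
  analyticOnNhd_gRep)
open Literature.MathematicalPhysics.QuantumFieldTheory.Balaban1983to89.B12Momentum511 (pderiv)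
open Literature.MathematicalPhysics.QuantumFieldTheory.Balaban1983to89.B12Eq531Symmetry (coeffA coeffB)

variable {d : ℕ}

/-! ## §1. `∂/∂z_κ` versus the Fréchet derivative -/

/-- `∂_κf(ζ) = Df(ζ)e_κ` for `f` complex-differentiable at `ζ`. [cite: Balaban1987RG1, (5.30) p.295] -/
theorem pderiv_eq_fderiv {f : (Fin d → ℂ) → ℂ} {ζ : Fin d → ℂ} (hf : DifferentiableAt ℂ f ζ) (κ : Fin d) :
    pderiv κ f ζ = fderiv ℂ f ζ (Pi.single κ 1) := by
  unfold pderiv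
  exact (hasDerivAt_slice_zero hf (Pi.single κ 1)).deriv

/-- `Df(ζ)v = Σ_κ v_κ ∂_κf(ζ)` for `f` complex-differentiable at `ζ`. [cite: Balaban1987RG1, (5.30) p.295] -/
theorem fderiv_apply_eq_sum_pderiv {f : (Fin d → ℂ) → ℂ} {ζ : Fin d → ℂ} (hf : DifferentiableAt ℂ f ζ)
    (v : Fin d → ℂ) : fderiv ℂ f ζ v = ∑ κ, v κ * pderiv κ f ζ := by
  have hv : v = ∑ κ, v κ • (Pi.single κ (1 : ℂ) : Fin d → ℂ) := by
    funext μ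
    simp [Finset.sum_apply, Pi.single_apply]
  conv_lhs => rw [hv]
  rw [map_sum]
  exact Finset.sum_congr rfl fun κ _ => by rw [map_smul, smul_eq_mul, pderiv_eq_fderiv hf]

/-- Locality: `∂_κ` depends only on the germ. [cite: Balaban1987RG1, (5.30) p.295] -/
theorem pderiv_congr_of_eventuallyEq {F G : (Fin d → ℂ) → ℂ} {ζ : Fin d → ℂ} (h : F =ᶠ[𝓝 ζ] G) (κ : Fin d) :
    pderiv κ F ζ = pderiv κ G ζ := by
  unfold pderiv
  have hc : Continuous fun t : ℂ => ζ + t • (Pi.single κ (1 : ℂ) : Fin d → ℂ) := by fun_prop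
  have ht : Filter.Tendsto (fun t : ℂ => ζ + t • (Pi.single κ (1 : ℂ) : Fin d → ℂ)) (𝓝 0) (𝓝 ζ) := by
    simpa using hc.tendsto 0
  have hev : (fun t : ℂ => F (ζ + t • (Pi.single κ (1 : ℂ) : Fin d → ℂ))) =ᶠ[𝓝 0]
      fun t : ℂ => G (ζ + t • (Pi.single κ (1 : ℂ) : Fin d → ℂ)) := ht.eventually h
  exact hev.deriv_eq

/-- Locality on an open set: functions that agree on an open `U` have the same partials on `U`.
[cite: Balaban1987RG1, (5.30) p.295] -/
theorem pderiv_congr_of_eqOn {F G : (Fin d → ℂ) → ℂ} {U : Set (Fin d → ℂ)} (hU : IsOpen U) (h : Set.EqOn F G U)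
    {ζ : Fin d → ℂ} (hζ : ζ ∈ U) (κ : Fin d) : pderiv κ F ζ = pderiv κ G ζ :=
  pderiv_congr_of_eventuallyEq (Filter.eventuallyEq_of_mem (hU.mem_nhds hζ) h) κ

/-- On an open `U`, the partial `∂_κf` of a holomorphic `f` agrees with `w ↦ Df(w)e_κ`. [cite: Balaban1987RG1, (5.30) p.295] -/
theorem pderiv_eqOn_fderiv {f : (Fin d → ℂ) → ℂ} {U : Set (Fin d → ℂ)} (hU : IsOpen U) (hf : DifferentiableOn ℂ f U)
    (κ : Fin d) : Set.EqOn (pderiv κ f) (fun w => fderiv ℂ f w (Pi.single κ 1)) U :=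
  fun _ hw => pderiv_eq_fderiv (hf.differentiableAt (hU.mem_nhds hw)) κ

/-- **Partials of holomorphic functions are holomorphic** (on the open set): `SCV.differentiableOn_fderiv_apply` +
locality. [cite: Balaban1987RG1, (5.30) p.295] -/
theorem differentiableOn_pderiv {f : (Fin d → ℂ) → ℂ} {U : Set (Fin d → ℂ)} (hU : IsOpen U) (hf : DifferentiableOn ℂ f U)
    (κ : Fin d) : DifferentiableOn ℂ (pderiv κ f) U := by
  intro ζ hζ
  have hev : pderiv κ f =ᶠ[𝓝 ζ] fun w => fderiv ℂ f w (Pi.single κ 1) :=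
    Filter.eventuallyEq_of_mem (hU.mem_nhds hζ) (pderiv_eqOn_fderiv hU hf κ)
  have hd : DifferentiableAt ℂ (fun w => fderiv ℂ f w (Pi.single κ 1)) ζ :=
    (differentiableOn_fderiv_apply hf hU (Pi.single κ 1)).differentiableAt (hU.mem_nhds hζ)
  exact (hev.differentiableAt_iff.mpr hd).differentiableWithinAt

/-- Linearity of `∂_κ` over finite sums with constant coefficients (terms differentiable at the point).
[cite: Balaban1987RG1, (5.30) p.295] -/
theorem pderiv_sum_mul {ι : Type*} (s : Finset ι) (c : ι → ℂ) {F : ι → (Fin d → ℂ) → ℂ} {ζ : Fin d → ℂ}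
    (hF : ∀ i ∈ s, DifferentiableAt ℂ (F i) ζ) (κ : Fin d) :
    pderiv κ (fun w => ∑ i ∈ s, c i * F i w) ζ = ∑ i ∈ s, c i * pderiv κ (F i) ζ := by
  unfold pderiv
  have hline : ∀ i ∈ s, DifferentiableAt ℂ (fun t : ℂ => F i (ζ + t • Pi.single κ 1)) 0 := by
    intro i hi
    have h0 : DifferentiableAt ℂ (F i) (ζ + (0 : ℂ) • (Pi.single κ (1 : ℂ) : Fin d → ℂ)) := by
      simpa using hF i hi
    exact h0.comp (0 : ℂ) (by fun_prop)
  rw [deriv_fun_sum fun i hi => (hline i hi).const_mul (c i)]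
  exact Finset.sum_congr rfl fun i hi => by rw [deriv_const_mul (c i) (hline i hi)]

/-! ## §2. The second-order Taylor formula with integral remainder along a complex segment -/

/-- The real parameter slice of a holomorphic `g`: `s ↦ g(x + sv)`, `s ∈ ℝ`, has derivative `Dg(x + tv)v` at `t`.
[cite: Balaban1987RG1, (5.30) p.295] -/
theorem hasDerivAt_realSlice {g : (Fin d → ℂ) → ℂ} {x v : Fin d → ℂ} {t : ℝ}
    (hg : DifferentiableAt ℂ g (x + (t : ℂ) • v)) :
    HasDerivAt (fun s : ℝ => g (x + (s : ℂ) • v)) (fderiv ℂ g (x + (t : ℂ) • v) v) t :=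
  (hasDerivAt_slice hg).comp_ofReal

/-- Along the segment: `d/dt (D_v^k f)(x + tv) = (D_v^{k+1} f)(x + tv)` at every real `t` with `x + tv ∈ U`.
[cite: Balaban1987RG1, (5.30) p.295] -/
theorem hasDerivAt_iter {f : (Fin d → ℂ) → ℂ} {U : Set (Fin d → ℂ)} (hU : IsOpen U) (hf : DifferentiableOn ℂ f U)
    (x v : Fin d → ℂ) (k : ℕ) {t : ℝ} (ht : x + (t : ℂ) • v ∈ U) :
    HasDerivAt (fun s : ℝ => ((fderiv ℂ · · v)^[k] f) (x + (s : ℂ) • v))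
      (((fderiv ℂ · · v)^[k + 1] f) (x + (t : ℂ) • v)) t := by
  rw [Function.iterate_succ_apply']
  exact hasDerivAt_realSlice ((differentiableOn_iterate_fderiv_apply hf hU v k).differentiableAt (hU.mem_nhds ht))

/-- **Second-order Taylor formula with integral remainder along a complex segment.**  If `f` is holomorphic on an open
`U` containing the segment `{x + tv : t ∈ [0,1]}`, then
`f(x + v) = f(x) + (D_vf)(x) + ½(D_v²f)(x) + ∫₀¹ ½(1 − t)²(D_v³f)(x + tv)dt`, `D_v^kf = (fderiv ℂ · · v)^[k]f`
(fundamental theorem of calculus for `H(t) = f(x + tv) + (1 − t)(D_vf)(x + tv) + ½(1 − t)²(D_v²f)(x + tv)`, whose derivative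
is `½(1 − t)²(D_v³f)(x + tv)`; real-`C³` one-variable sibling: `B14Eq369ThirdOrder.taylor3_integral_remainder`).
[cite: Balaban1987RG1, (5.30) p.295] -/
theorem taylor2_segment {f : (Fin d → ℂ) → ℂ} {U : Set (Fin d → ℂ)} (hU : IsOpen U) (hf : DifferentiableOn ℂ f U)
    {x v : Fin d → ℂ} (hseg : ∀ t ∈ Set.Icc (0 : ℝ) 1, x + (t : ℂ) • v ∈ U) :
    f (x + v) = f x + ((fderiv ℂ · · v)^[1] f) x + (1 / 2 : ℂ) * ((fderiv ℂ · · v)^[2] f) x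
      + ∫ t in (0 : ℝ)..1, (1 / 2 : ℂ) * (1 - (t : ℂ)) ^ 2 * ((fderiv ℂ · · v)^[3] f) (x + (t : ℂ) • v) := by
  -- `H(s) = f(x + sv) + (1 − s)(D_vf)(x + sv) + ½(1 − s)(1 − s)(D_v²f)(x + sv)` has `H'(t) = ½(1 − t)²(D_v³f)(x + tv)`
  have hderiv : ∀ t ∈ Set.uIcc (0 : ℝ) 1, HasDerivAt
      (fun s : ℝ => f (x + (s : ℂ) • v) + (1 - (s : ℂ)) * ((fderiv ℂ · · v)^[1] f) (x + (s : ℂ) • v)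
        + (1 / 2 : ℂ) * ((1 - (s : ℂ)) * (1 - (s : ℂ))) * ((fderiv ℂ · · v)^[2] f) (x + (s : ℂ) • v))
      ((1 / 2 : ℂ) * (1 - (t : ℂ)) ^ 2 * ((fderiv ℂ · · v)^[3] f) (x + (t : ℂ) • v)) t := by
    intro t ht
    rw [Set.uIcc_of_le zero_le_one] at ht
    have hmem := hseg t ht
    have h0 := hasDerivAt_iter hU hf x v 0 hmem
    have h1 := hasDerivAt_iter hU hf x v 1 hmem
    have h2 := hasDerivAt_iter hU hf x v 2 hmem
    simp only [Function.iterate_zero_apply, zero_add, Nat.reduceAdd] at h0 h1 h2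
    have hc : HasDerivAt (fun s : ℝ => (s : ℂ)) 1 t := by
      simpa using (hasDerivAt_id t).ofReal_comp
    have hl1 : HasDerivAt (fun s : ℝ => 1 - (s : ℂ)) (-1) t := hc.const_sub 1
    have hl2 := (hl1.fun_mul hl1).const_mul (1 / 2 : ℂ)
    have hsum := (h0.fun_add (hl1.fun_mul h1)).fun_add (hl2.fun_mul h2)
    refine hsum.congr_deriv ?_
    ring
  have hcont : ContinuousOn
      (fun t : ℝ => (1 / 2 : ℂ) * (1 - (t : ℂ)) ^ 2 * ((fderiv ℂ · · v)^[3] f) (x + (t : ℂ) • v))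
      (Set.uIcc (0 : ℝ) 1) := by
    refine ContinuousOn.mul (Continuous.continuousOn (by fun_prop)) ?_
    have hD3 : ContinuousOn ((fderiv ℂ · · v)^[3] f) U := (differentiableOn_iterate_fderiv_apply hf hU v 3).continuousOn
    refine hD3.comp (Continuous.continuousOn (by fun_prop : Continuous fun t : ℝ => x + (t : ℂ) • v)) ?_
    intro t ht
    rw [Set.uIcc_of_le zero_le_one] at ht
    exact hseg t ht
  have hftc := intervalIntegral.integral_eq_sub_of_hasDerivAt hderiv (hcont.intervalIntegrable (μ := volume))
  rw [hftc]
  simp only [Complex.ofReal_one, Complex.ofReal_zero, sub_self, one_smul, zero_smul, add_zero, sub_zero]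
  ring

/-! ## §3. Coordinates: `D_v^k f` as `k`-fold sums of partial derivatives -/

/-- `(D_vf)(ζ) = Σ_κ v_κ(∂_κf)(ζ)` on `U`. [cite: Balaban1987RG1, (5.30) p.295] -/
theorem iter_one_apply {f : (Fin d → ℂ) → ℂ} {U : Set (Fin d → ℂ)} (hU : IsOpen U) (hf : DifferentiableOn ℂ f U)
    (v : Fin d → ℂ) {ζ : Fin d → ℂ} (hζ : ζ ∈ U) :
    ((fderiv ℂ · · v)^[1] f) ζ = ∑ κ, v κ * pderiv κ f ζ := by
  rw [Function.iterate_one]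
  exact fderiv_apply_eq_sum_pderiv (hf.differentiableAt (hU.mem_nhds hζ)) v

/-- `(D_v²f)(ζ) = Σ_κ v_κ Σ_λ v_λ(∂_κ∂_λf)(ζ)` on `U`. [cite: Balaban1987RG1, (5.30) p.295] -/
theorem iter_two_apply {f : (Fin d → ℂ) → ℂ} {U : Set (Fin d → ℂ)} (hU : IsOpen U) (hf : DifferentiableOn ℂ f U)
    (v : Fin d → ℂ) {ζ : Fin d → ℂ} (hζ : ζ ∈ U) :
    ((fderiv ℂ · · v)^[2] f) ζ = ∑ κ, v κ * ∑ l, v l * pderiv κ (pderiv l f) ζ := by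
  have h1 : DifferentiableOn ℂ ((fderiv ℂ · · v)^[1] f) U := differentiableOn_iterate_fderiv_apply hf hU v 1
  rw [show ((fderiv ℂ · · v)^[2] f) = fun w => fderiv ℂ ((fderiv ℂ · · v)^[1] f) w v from
    Function.iterate_succ_apply' _ 1 f]
  dsimp only
  rw [fderiv_apply_eq_sum_pderiv (h1.differentiableAt (hU.mem_nhds hζ)) v]
  refine Finset.sum_congr rfl fun κ _ => ?_
  congr 1
  rw [pderiv_congr_of_eqOn hU (fun w hw => iter_one_apply hU hf v hw) hζ κ]
  exact pderiv_sum_mul Finset.univ v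
    (fun l _ => (differentiableOn_pderiv hU hf l).differentiableAt (hU.mem_nhds hζ)) κ

/-- `(D_v³f)(ζ) = Σ_κ v_κ Σ_λ v_λ Σ_ρ v_ρ(∂_κ∂_λ∂_ρf)(ζ)` on `U`. [cite: Balaban1987RG1, (5.30) p.295] -/
theorem iter_three_apply {f : (Fin d → ℂ) → ℂ} {U : Set (Fin d → ℂ)} (hU : IsOpen U) (hf : DifferentiableOn ℂ f U)
    (v : Fin d → ℂ) {ζ : Fin d → ℂ} (hζ : ζ ∈ U) :
    ((fderiv ℂ · · v)^[3] f) ζ = ∑ κ, v κ * ∑ l, v l * ∑ ρ, v ρ * pderiv κ (pderiv l (pderiv ρ f)) ζ := by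
  have h2 : DifferentiableOn ℂ ((fderiv ℂ · · v)^[2] f) U := differentiableOn_iterate_fderiv_apply hf hU v 2
  rw [show ((fderiv ℂ · · v)^[3] f) = fun w => fderiv ℂ ((fderiv ℂ · · v)^[2] f) w v from
    Function.iterate_succ_apply' _ 2 f]
  dsimp only
  rw [fderiv_apply_eq_sum_pderiv (h2.differentiableAt (hU.mem_nhds hζ)) v]
  refine Finset.sum_congr rfl fun κ _ => ?_
  congr 1
  rw [pderiv_congr_of_eqOn hU (fun w hw => iter_two_apply hU hf v hw) hζ κ]
  have hF : ∀ l ∈ (Finset.univ : Finset (Fin d)),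
      DifferentiableAt ℂ (fun w => ∑ ρ, v ρ * pderiv l (pderiv ρ f) w) ζ := fun l _ =>
    DifferentiableAt.fun_sum fun ρ _ =>
      (((differentiableOn_pderiv hU (differentiableOn_pderiv hU hf ρ) l).differentiableAt
        (hU.mem_nhds hζ)).const_mul (v ρ))
  rw [pderiv_sum_mul Finset.univ v hF κ]
  refine Finset.sum_congr rfl fun l _ => ?_
  congr 1
  exact pderiv_sum_mul Finset.univ v
    (fun ρ _ => (differentiableOn_pderiv hU (differentiableOn_pderiv hU hf ρ) l).differentiableAt (hU.mem_nhds hζ)) κ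

/-! ## §4. (5.30) on the polydisc `×_μ{|z_μ| < e^{a}}` -/

/-- The remainder functions of (5.30): `g_{κλρ}(z) = ∫₀¹ ½(1 − t)²(∂³/∂z_κ∂z_λ∂z_ρ g)(1 + t(z − 1))dt`.
[cite: Balaban1987RG1, (5.30) p.295] -/
def rem530 (g : (Fin d → ℂ) → ℂ) (κ l ρ : Fin d) (z : Fin d → ℂ) : ℂ :=
  ∫ t in (0 : ℝ)..1, (1 / 2 : ℂ) * (1 - (t : ℂ)) ^ 2
    * pderiv κ (pderiv l (pderiv ρ g)) ((fun _ => (1 : ℂ)) + (t : ℂ) • (z - fun _ => (1 : ℂ)))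

/-- The polydisc `×_μ{|z_μ| < e^{a}}`, `a > 0`, contains the segment from `1` to each of its points:
`|1 + t(z_μ − 1)| ≤ (1 − t) + t|z_μ| < e^{a}`. [cite: Balaban1987RG1, (5.30) p.295] -/
theorem segment_mem_openPolyDisc {a : ℝ} (ha : 0 < a) {z : Fin d → ℂ} (hz : z ∈ OpenPolyDisc d a) {t : ℝ}
    (ht : t ∈ Set.Icc (0 : ℝ) 1) : (fun _ => (1 : ℂ)) + (t : ℂ) • (z - fun _ => (1 : ℂ)) ∈ OpenPolyDisc d a := by
  intro j
  have h1 : (1 : ℝ) < Real.exp a := by simpa using Real.one_lt_exp_iff.mpr ha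
  have hzj := hz j
  have heq : (((fun _ => (1 : ℂ)) + (t : ℂ) • (z - fun _ => (1 : ℂ)) : Fin d → ℂ) j)
      = ((1 - t : ℝ) : ℂ) + (t : ℂ) * z j := by
    simp only [Pi.add_apply, Pi.smul_apply, Pi.sub_apply, smul_eq_mul]
    push_cast
    ring
  rw [heq]
  calc ‖((1 - t : ℝ) : ℂ) + (t : ℂ) * z j‖ ≤ ‖((1 - t : ℝ) : ℂ)‖ + ‖(t : ℂ) * z j‖ := norm_add_le _ _
    _ = (1 - t) + t * ‖z j‖ := by
        rw [norm_mul, Complex.norm_real, Complex.norm_real, Real.norm_of_nonneg (by linarith [ht.2]),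
          Real.norm_of_nonneg ht.1]
    _ < Real.exp a := by
        rcases eq_or_lt_of_le ht.1 with h0 | hpos
        · rw [← h0]; simpa using h1
        · nlinarith [mul_lt_mul_of_pos_left hzj hpos, ht.2, h1]

/-- **(5.30)** — for every `g` holomorphic on the open polydisc `×_μ{|z_μ| < e^{a}}` (`a > 0`) and every `z` in it:
`g(z) = g(1) + Σ_κ(z_κ − 1)(∂_κg)(1) + ½Σ_{κ,λ}(z_κ − 1)(z_λ − 1)(∂_κ∂_λg)(1) + Σ_{κ,λ,ρ}(z_κ − 1)(z_λ − 1)(z_ρ − 1)g_{κλρ}(z)`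
with the integral remainders `g_{κλρ} = rem530 g κ λ ρ`. [cite: Balaban1987RG1, (5.30) p.295] -/
theorem eq530 {a : ℝ} (ha : 0 < a) {g : (Fin d → ℂ) → ℂ} (hg : DifferentiableOn ℂ g (OpenPolyDisc d a))
    {z : Fin d → ℂ} (hz : z ∈ OpenPolyDisc d a) :
    g z = g (fun _ => 1) + ∑ κ, (z κ - 1) * pderiv κ g (fun _ => 1)
      + (1 / 2 : ℂ) * ∑ κ, ∑ l, (z κ - 1) * (z l - 1) * pderiv κ (pderiv l g) (fun _ => 1)
      + ∑ κ, ∑ l, ∑ ρ, (z κ - 1) * (z l - 1) * (z ρ - 1) * rem530 g κ l ρ z := by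
  set U : Set (Fin d → ℂ) := OpenPolyDisc d a with hUdef
  have hU : IsOpen U := isOpen_openPolyDisc d a
  set x : Fin d → ℂ := fun _ => 1 with hx
  set v : Fin d → ℂ := z - x with hv
  have hseg : ∀ t ∈ Set.Icc (0 : ℝ) 1, x + (t : ℂ) • v ∈ U := fun t ht => segment_mem_openPolyDisc ha hz ht
  have h1U : x ∈ U := by simpa using hseg 0 ⟨le_refl 0, zero_le_one⟩
  have hT := taylor2_segment hU hg hseg
  have hxv : x + v = z := by simp [hv]
  rw [hxv] at hT
  rw [hT, iter_one_apply hU hg v h1U, iter_two_apply hU hg v h1U]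
  -- the first- and second-order sums
  have hvap : ∀ κ, v κ = z κ - 1 := fun κ => by simp [hv, hx]
  have e1 : ∑ κ, v κ * pderiv κ g x = ∑ κ, (z κ - 1) * pderiv κ g x :=
    Finset.sum_congr rfl fun κ _ => by rw [hvap]
  have e2 : (1 / 2 : ℂ) * ∑ κ, v κ * ∑ l, v l * pderiv κ (pderiv l g) x
      = (1 / 2 : ℂ) * ∑ κ, ∑ l, (z κ - 1) * (z l - 1) * pderiv κ (pderiv l g) x := by
    congr 1
    refine Finset.sum_congr rfl fun κ _ => ?_
    rw [Finset.mul_sum]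
    exact Finset.sum_congr rfl fun l _ => by rw [hvap, hvap]; ring
  -- the remainder: continuity of the third partials along the segment
  have h3 : ∀ κ l ρ, DifferentiableOn ℂ (pderiv κ (pderiv l (pderiv ρ g))) U := fun κ l ρ =>
    differentiableOn_pderiv hU (differentiableOn_pderiv hU (differentiableOn_pderiv hU hg ρ) l) κ
  have hTcont : ∀ κ l ρ, ContinuousOn (fun t : ℝ => (z κ - 1) * (z l - 1) * (z ρ - 1)
      * ((1 / 2 : ℂ) * (1 - (t : ℂ)) ^ 2 * pderiv κ (pderiv l (pderiv ρ g)) (x + (t : ℂ) • v))) (Set.uIcc (0 : ℝ) 1) := by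
    intro κ l ρ
    refine ContinuousOn.mul continuousOn_const (ContinuousOn.mul (Continuous.continuousOn (by fun_prop)) ?_)
    refine (h3 κ l ρ).continuousOn.comp (Continuous.continuousOn (by fun_prop : Continuous fun t : ℝ => x + (t : ℂ) • v)) ?_
    intro t ht
    rw [Set.uIcc_of_le zero_le_one] at ht
    exact hseg t ht
  have e3 : ∫ t in (0 : ℝ)..1, (1 / 2 : ℂ) * (1 - (t : ℂ)) ^ 2 * ((fderiv ℂ · · v)^[3] g) (x + (t : ℂ) • v)
      = ∑ κ, ∑ l, ∑ ρ, (z κ - 1) * (z l - 1) * (z ρ - 1) * rem530 g κ l ρ z := by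
    have hcongr : Set.EqOn
        (fun t : ℝ => (1 / 2 : ℂ) * (1 - (t : ℂ)) ^ 2 * ((fderiv ℂ · · v)^[3] g) (x + (t : ℂ) • v))
        (fun t : ℝ => ∑ κ, ∑ l, ∑ ρ, (z κ - 1) * (z l - 1) * (z ρ - 1)
          * ((1 / 2 : ℂ) * (1 - (t : ℂ)) ^ 2 * pderiv κ (pderiv l (pderiv ρ g)) (x + (t : ℂ) • v)))
        (Set.uIcc (0 : ℝ) 1) := by
      intro t ht
      rw [Set.uIcc_of_le zero_le_one] at ht
      simp only [iter_three_apply hU hg v (hseg t ht), Finset.mul_sum]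
      refine Finset.sum_congr rfl fun κ _ => Finset.sum_congr rfl fun l _ => Finset.sum_congr rfl fun ρ _ => ?_
      rw [hvap, hvap, hvap]
      ring
    rw [intervalIntegral.integral_congr hcongr]
    rw [intervalIntegral.integral_finsetSum fun κ _ =>
      (continuousOn_finsetSum _ fun l _ => continuousOn_finsetSum _ fun ρ _ => hTcont κ l ρ).intervalIntegrable]
    refine Finset.sum_congr rfl fun κ _ => ?_
    rw [intervalIntegral.integral_finsetSum fun l _ =>
      (continuousOn_finsetSum _ fun ρ _ => hTcont κ l ρ).intervalIntegrable]
    refine Finset.sum_congr rfl fun l _ => ?_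
    rw [intervalIntegral.integral_finsetSum fun ρ _ => (hTcont κ l ρ).intervalIntegrable]
    refine Finset.sum_congr rfl fun ρ _ => ?_
    rw [intervalIntegral.integral_const_mul]
    rfl
  rw [e1, e2, e3]

/-- **(5.30) for the paper's `g_{μν}`** (= `B12Rep526Coeff.gRep c μ ν`, analytic on the polydisc `×_μ{|z_μ| < e^{δ₁}}` by
`B12Rep526Analytic.analyticOnNhd_gRep` under the (5.10)-type bound `ExpBound a M (Π_{μν})`, `a = δ₁ > 0`): for every `z` in
the polydisc, `g_{μν}(z) = g_{μν}(1) + Σ_κ a_{μν,κ}(z_κ − 1) + ½Σ_{κ,λ} b_{μν,κλ}(z_κ − 1)(z_λ − 1)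
+ Σ_{κ,λ,ρ} g_{μν,κλρ}(z)(z_κ − 1)(z_λ − 1)(z_ρ − 1)` with `a_{μν,κ} = B12Eq531Symmetry.coeffA`, `b_{μν,κλ} = coeffB` and the
integral remainders `g_{μν,κλρ} = rem530 (gRep c μ ν) κ λ ρ`. [cite: Balaban1987RG1, (5.30) p.295] -/
theorem eq530_gRep {a M : ℝ} (ha : 0 < a) {c : Fin d → Fin d → Pt d → ℂ} {μ ν : Fin d}
    (hc : ExpBound a M (c μ ν)) {z : Fin d → ℂ} (hz : z ∈ OpenPolyDisc d a) :
    gRep c μ ν z = gRep c μ ν (fun _ => 1) + ∑ κ, coeffA (gRep c) μ ν κ * (z κ - 1)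
      + (1 / 2 : ℂ) * ∑ κ, ∑ l, coeffB (gRep c) μ ν κ l * ((z κ - 1) * (z l - 1))
      + ∑ κ, ∑ l, ∑ ρ, rem530 (gRep c μ ν) κ l ρ z * ((z κ - 1) * (z l - 1) * (z ρ - 1)) := by
  have h := eq530 ha (analyticOnNhd_gRep hc).differentiableOn hz
  rw [h]
  unfold coeffA coeffB
  congr 1
  · congr 1
    · congr 1
      exact Finset.sum_congr rfl fun κ _ => mul_comm _ _
    · congr 1
      exact Finset.sum_congr rfl fun κ _ => Finset.sum_congr rfl fun l _ => mul_comm _ _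
  · exact Finset.sum_congr rfl fun κ _ => Finset.sum_congr rfl fun l _ =>
      Finset.sum_congr rfl fun ρ _ => mul_comm _ _

/-! ## §5. «the functions are analytic on the polydisc»: the remainder functions `g_{κλρ}` -/

/-- **The remainder functions `g_{κλρ}` of (5.30) are holomorphic on the open polydisc `×_μ{|z_μ| < e^{a}}` whenever `g`
is**: `rem530 g κ λ ρ` is the integral over `t ∈ (0,1]` of the holomorphic family `z ↦ ½(1 − t)²(∂_κ∂_λ∂_ρg)(1 + t(z − 1))`
(the affine maps `z ↦ 1 + t(z − 1)`, `t ∈ [0,1]`, map the polydisc into itself), dominated on a small ball around each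
point by the bound of the continuous `∂³g` on the compact set `{1 + t(w − 1) : t ∈ [0,1], w in the closed ball}`; holomorphy
of dominated parameter integrals (`Literature.Analysis.Complex.differentiableOn_integral_of_dominated`).
[cite: Balaban1987RG1, (5.30) p.295] -/
theorem differentiableOn_rem530 {a : ℝ} (ha : 0 < a) {g : (Fin d → ℂ) → ℂ}
    (hg : DifferentiableOn ℂ g (OpenPolyDisc d a)) (κ l ρ : Fin d) :
    DifferentiableOn ℂ (rem530 g κ l ρ) (OpenPolyDisc d a) := by
  set U : Set (Fin d → ℂ) := OpenPolyDisc d a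
  have hU : IsOpen U := isOpen_openPolyDisc d a
  set h : (Fin d → ℂ) → ℂ := pderiv κ (pderiv l (pderiv ρ g)) with hh
  have hhol : DifferentiableOn ℂ h U :=
    differentiableOn_pderiv hU (differentiableOn_pderiv hU (differentiableOn_pderiv hU hg ρ) l) κ
  set A : ℝ → (Fin d → ℂ) → (Fin d → ℂ) := fun t z => (fun _ => (1 : ℂ)) + (t : ℂ) • (z - fun _ => (1 : ℂ))
    with hA
  have hAmaps : ∀ t ∈ Set.Icc (0 : ℝ) 1, Set.MapsTo (A t) U U := fun t ht z hz =>
    segment_mem_openPolyDisc ha hz ht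
  have hAdiff : ∀ t : ℝ, Differentiable ℂ (A t) := fun t => by
    simp only [hA]; fun_prop
  have hAcont : Continuous fun p : ℝ × (Fin d → ℂ) => A p.1 p.2 := by
    simp only [hA]; fun_prop
  have hAcont1 : ∀ z : Fin d → ℂ, Continuous fun t : ℝ => A t z := fun z => by
    simp only [hA]; fun_prop
  have hrw : rem530 g κ l ρ = fun z => ∫ t in Set.Ioc (0 : ℝ) 1, (1 / 2 : ℂ) * (1 - (t : ℂ)) ^ 2 * h (A t z) := by
    funext z
    unfold rem530
    exact intervalIntegral.integral_of_le zero_le_one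
  rw [hrw]
  refine differentiableOn_integral_of_dominated (μ := volume.restrict (Set.Ioc (0 : ℝ) 1))
    (F := fun z t => (1 / 2 : ℂ) * (1 - (t : ℂ)) ^ 2 * h (A t z)) ?_ ?_ ?_
  · -- measurability of the slices: continuity on `(0,1]`
    intro z hz
    refine ContinuousOn.aestronglyMeasurable ?_ measurableSet_Ioc
    refine ContinuousOn.mul (Continuous.continuousOn (by fun_prop)) ?_
    exact hhol.continuousOn.comp (hAcont1 z).continuousOn fun t ht => hAmaps t (Set.Ioc_subset_Icc_self ht) hz
  · -- holomorphy in `z` for each `t ∈ (0,1]`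
    refine (ae_restrict_iff' measurableSet_Ioc).mpr (Filter.Eventually.of_forall fun t ht => ?_)
    exact (hhol.comp (hAdiff t).differentiableOn (hAmaps t (Set.Ioc_subset_Icc_self ht))).const_mul
      ((1 / 2 : ℂ) * (1 - (t : ℂ)) ^ 2)
  · -- local domination by a constant
    intro z₀ hz₀
    obtain ⟨r, hr, hrU⟩ := Metric.isOpen_iff.mp hU z₀ hz₀
    have hcb : Metric.closedBall z₀ (r / 2) ⊆ U := (Metric.closedBall_subset_ball (half_lt_self hr)).trans hrU
    set K : Set (Fin d → ℂ) :=
      (fun p : ℝ × (Fin d → ℂ) => A p.1 p.2) '' (Set.Icc (0 : ℝ) 1 ×ˢ Metric.closedBall z₀ (r / 2)) with hK_def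
    have hK : IsCompact K := (isCompact_Icc.prod (isCompact_closedBall z₀ (r / 2))).image hAcont
    have hKU : K ⊆ U := by
      rintro _ ⟨⟨t, z⟩, ⟨ht, hz⟩, rfl⟩
      exact hAmaps t ht (hcb hz)
    obtain ⟨C, hC⟩ := hK.exists_bound_of_continuousOn (hhol.continuousOn.mono hKU)
    have hI : IntegrableOn (fun _ : ℝ => 1 / 2 * C) (Set.Ioc (0 : ℝ) 1) volume :=
      integrableOn_const (by rw [Real.volume_Ioc]; exact ENNReal.ofReal_ne_top)
    refine ⟨r / 2, half_pos hr, Metric.ball_subset_closedBall.trans hcb, fun _ => 1 / 2 * C, hI, ?_⟩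
    refine (ae_restrict_iff' measurableSet_Ioc).mpr (Filter.Eventually.of_forall fun t ht z hz => ?_)
    have hmem : A t z ∈ K := ⟨(t, z), ⟨Set.Ioc_subset_Icc_self ht, Metric.ball_subset_closedBall hz⟩, rfl⟩
    have hCz := hC _ hmem
    have hn1 : ‖(1 : ℂ) - (t : ℂ)‖ = 1 - t := by
      rw [← Complex.ofReal_one, ← Complex.ofReal_sub, Complex.norm_real, Real.norm_of_nonneg (by linarith [ht.2])]
    have hhalf : ‖(1 / 2 : ℂ)‖ = 1 / 2 := by norm_num
    simp only [norm_mul, norm_pow, hn1, hhalf]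
    have hsq : (1 - t) ^ 2 ≤ 1 := by nlinarith [ht.1, ht.2]
    nlinarith [norm_nonneg (h (A t z)), hsq, hCz]

/-- **«The functions are analytic on the polydisc»**: the remainder functions `g_{κλρ} = rem530 g κ λ ρ` are analytic on
`×_μ{|z_μ| < e^{a}}` whenever `g` is holomorphic there (holomorphic ⇒ analytic in several variables,
`SCV.analyticOnNhd_of_differentiableOn`). [cite: Balaban1987RG1, (5.30) p.295] -/
theorem analyticOnNhd_rem530 {a : ℝ} (ha : 0 < a) {g : (Fin d → ℂ) → ℂ}
    (hg : DifferentiableOn ℂ g (OpenPolyDisc d a)) (κ l ρ : Fin d) :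
    AnalyticOnNhd ℂ (rem530 g κ l ρ) (OpenPolyDisc d a) :=
  analyticOnNhd_of_differentiableOn (differentiableOn_rem530 ha hg κ l ρ) (isOpen_openPolyDisc d a)

/-- For the paper's `g_{μν}`: the functions `g_{μν,κλρ}` of (5.30) are analytic on the polydisc `×_μ{|z_μ| < e^{δ₁}}`
(`a = δ₁`, under the (5.10)-type bound on `Π_{μν}`). [cite: Balaban1987RG1, (5.30) p.295] -/
theorem analyticOnNhd_rem530_gRep {a M : ℝ} (ha : 0 < a) {c : Fin d → Fin d → Pt d → ℂ} {μ ν : Fin d}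
    (hc : ExpBound a M (c μ ν)) (κ l ρ : Fin d) :
    AnalyticOnNhd ℂ (rem530 (gRep c μ ν) κ l ρ) (OpenPolyDisc d a) :=
  analyticOnNhd_rem530 ha (analyticOnNhd_gRep hc).differentiableOn κ l ρ

/-! ## §6. «The coefficients a, b and the functions g above are real for real values of z» -/

/-- **Partials of a holomorphic function that is real at real points are real at real points.**  If `g` is holomorphic
on an open `U ⊆ ℂ^d` and `g(w) ∈ ℝ` for every real point `w ∈ U`, then `(∂_κg)(w) ∈ ℝ` at every real point `w ∈ U`: the
derivative along the REAL coordinate line `r ↦ w + re_κ` (real points of `U` for small `r`) of the real function `g` is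
real, and it equals `∂_κg(w)`. [cite: Balaban1987RG1, (5.30) p.295] -/
theorem im_pderiv_eq_zero {g : (Fin d → ℂ) → ℂ} {U : Set (Fin d → ℂ)} (hU : IsOpen U) (hg : DifferentiableOn ℂ g U)
    (hreal : ∀ t : Fin d → ℝ, (fun j => (t j : ℂ)) ∈ U → (g fun j => (t j : ℂ)).im = 0) (κ : Fin d)
    {t : Fin d → ℝ} (ht : (fun j => (t j : ℂ)) ∈ U) : (pderiv κ g fun j => (t j : ℂ)).im = 0 := by
  set ζ : Fin d → ℂ := fun j => (t j : ℂ) with hζ_def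
  set e : Fin d → ℂ := Pi.single κ 1 with he_def
  have hζ : DifferentiableAt ℂ g ζ := hg.differentiableAt (hU.mem_nhds ht)
  -- the slice along the real coordinate line and its derivative `∂_κ g(ζ)`
  have hφ : HasDerivAt (fun s : ℂ => g (ζ + s • e)) (pderiv κ g ζ) 0 := by
    rw [pderiv_eq_fderiv hζ κ]
    exact hasDerivAt_slice_zero hζ e
  have hφr : HasDerivAt (fun r : ℝ => g (ζ + (r : ℂ) • e)) (pderiv κ g ζ) 0 := by
    have h0 : HasDerivAt (fun s : ℂ => g (ζ + s • e)) (pderiv κ g ζ) ((0 : ℝ) : ℂ) := by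
      rw [Complex.ofReal_zero]; exact hφ
    exact h0.comp_ofReal
  have him : HasDerivAt (fun r : ℝ => (g (ζ + (r : ℂ) • e)).im) (pderiv κ g ζ).im 0 := by
    simpa [Function.comp_def] using Complex.imCLM.hasFDerivAt.comp_hasDerivAt (0 : ℝ) hφr
  -- near `r = 0` the real points `ζ + r e_κ` lie in `U`, where `g` is real
  have hzero : (fun r : ℝ => (g (ζ + (r : ℂ) • e)).im) =ᶠ[𝓝 0] fun _ => 0 := by
    have hc : Continuous fun r : ℝ => ζ + (r : ℂ) • e := by fun_prop
    have ho : IsOpen ((fun r : ℝ => ζ + (r : ℂ) • e) ⁻¹' U) := hU.preimage hc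
    have h0 : (0 : ℝ) ∈ (fun r : ℝ => ζ + (r : ℂ) • e) ⁻¹' U := by
      show ζ + ((0 : ℝ) : ℂ) • e ∈ U
      simpa using ht
    filter_upwards [ho.mem_nhds h0] with r hr
    have hpt : ζ + (r : ℂ) • e = fun j => ((t j + r * (Pi.single κ (1 : ℝ) : Fin d → ℝ) j : ℝ) : ℂ) := by
      funext j
      simp only [hζ_def, he_def, Pi.add_apply, Pi.smul_apply, smul_eq_mul, Pi.single_apply]
      split_ifs <;> push_cast <;> ring
    have hr' : ζ + (r : ℂ) • e ∈ U := hr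
    rw [hpt] at hr' ⊢
    exact hreal _ hr'
  exact (him.congr_of_eventuallyEq hzero.symm).unique (hasDerivAt_const _ _)

/-- Second partials of a holomorphic function real at real points are real at real points.
[cite: Balaban1987RG1, (5.30) p.295] -/
theorem im_pderiv_pderiv_eq_zero {g : (Fin d → ℂ) → ℂ} {U : Set (Fin d → ℂ)} (hU : IsOpen U)
    (hg : DifferentiableOn ℂ g U)
    (hreal : ∀ t : Fin d → ℝ, (fun j => (t j : ℂ)) ∈ U → (g fun j => (t j : ℂ)).im = 0) (κ l : Fin d)
    {t : Fin d → ℝ} (ht : (fun j => (t j : ℂ)) ∈ U) : (pderiv κ (pderiv l g) fun j => (t j : ℂ)).im = 0 :=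
  im_pderiv_eq_zero hU (differentiableOn_pderiv hU hg l) (fun _ ht' => im_pderiv_eq_zero hU hg hreal l ht') κ ht

/-- Third partials of a holomorphic function real at real points are real at real points.
[cite: Balaban1987RG1, (5.30) p.295] -/
theorem im_pderiv_pderiv_pderiv_eq_zero {g : (Fin d → ℂ) → ℂ} {U : Set (Fin d → ℂ)} (hU : IsOpen U)
    (hg : DifferentiableOn ℂ g U)
    (hreal : ∀ t : Fin d → ℝ, (fun j => (t j : ℂ)) ∈ U → (g fun j => (t j : ℂ)).im = 0) (κ l ρ : Fin d)
    {t : Fin d → ℝ} (ht : (fun j => (t j : ℂ)) ∈ U) :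
    (pderiv κ (pderiv l (pderiv ρ g)) fun j => (t j : ℂ)).im = 0 :=
  im_pderiv_pderiv_eq_zero hU (differentiableOn_pderiv hU hg ρ) (fun _ ht' => im_pderiv_eq_zero hU hg hreal ρ ht')
    κ l ht

/-- **The remainder functions `g_{κλρ}` are real at real points of the polydisc** when `g` is holomorphic there and
real at its real points: the integrand `½(1 − s)²(∂³g)(1 + s(z − 1))` is real for real `z` and `s ∈ [0,1]`.
[cite: Balaban1987RG1, (5.30) p.295] -/
theorem im_rem530_eq_zero {a : ℝ} (ha : 0 < a) {g : (Fin d → ℂ) → ℂ} (hg : DifferentiableOn ℂ g (OpenPolyDisc d a))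
    (hreal : ∀ t : Fin d → ℝ, (fun j => (t j : ℂ)) ∈ OpenPolyDisc d a → (g fun j => (t j : ℂ)).im = 0)
    (κ l ρ : Fin d) {t : Fin d → ℝ} (ht : (fun j => (t j : ℂ)) ∈ OpenPolyDisc d a) :
    (rem530 g κ l ρ fun j => (t j : ℂ)).im = 0 := by
  have hU : IsOpen (OpenPolyDisc d a) := isOpen_openPolyDisc d a
  unfold rem530
  set h : (Fin d → ℂ) → ℂ := pderiv κ (pderiv l (pderiv ρ g)) with hh
  set z : Fin d → ℂ := fun j => (t j : ℂ) with hz_def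
  have hhol : DifferentiableOn ℂ h (OpenPolyDisc d a) :=
    differentiableOn_pderiv hU (differentiableOn_pderiv hU (differentiableOn_pderiv hU hg ρ) l) κ
  have hseg : ∀ s ∈ Set.Icc (0 : ℝ) 1, (fun _ => (1 : ℂ)) + (s : ℂ) • (z - fun _ => (1 : ℂ)) ∈ OpenPolyDisc d a :=
    fun s hs => segment_mem_openPolyDisc ha ht hs
  -- the integrand is continuous on `[0,1]`, hence integrable
  have hcont : ContinuousOn (fun s : ℝ => (1 / 2 : ℂ) * (1 - (s : ℂ)) ^ 2
      * h ((fun _ => (1 : ℂ)) + (s : ℂ) • (z - fun _ => (1 : ℂ)))) (Set.uIcc (0 : ℝ) 1) := by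
    refine ContinuousOn.mul (Continuous.continuousOn (by fun_prop)) ?_
    refine hhol.continuousOn.comp (Continuous.continuousOn (by fun_prop)) ?_
    intro s hs
    rw [Set.uIcc_of_le zero_le_one] at hs
    exact hseg s hs
  have hswap := Complex.imCLM.intervalIntegral_comp_comm (hcont.intervalIntegrable (μ := volume))
  rw [Complex.imCLM_apply] at hswap
  rw [← hswap]
  -- and it is real on `[0,1]`
  refine (intervalIntegral.integral_congr fun s hs => ?_).trans intervalIntegral.integral_zero
  rw [Set.uIcc_of_le zero_le_one] at hs
  have hpt : ((fun _ => (1 : ℂ)) + (s : ℂ) • (z - fun _ => (1 : ℂ)) : Fin d → ℂ)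
      = fun j => ((1 + s * (t j - 1) : ℝ) : ℂ) := by
    funext j
    simp only [hz_def, Pi.add_apply, Pi.smul_apply, Pi.sub_apply, smul_eq_mul]
    push_cast
    ring
  have hw : (fun j => ((1 + s * (t j - 1) : ℝ) : ℂ)) ∈ OpenPolyDisc d a := hpt ▸ hseg s hs
  have hreal3 : (h fun j => ((1 + s * (t j - 1) : ℝ) : ℂ)).im = 0 :=
    im_pderiv_pderiv_pderiv_eq_zero hU hg hreal κ l ρ hw
  have hc : (1 / 2 : ℂ) * (1 - (s : ℂ)) ^ 2 = (((1 / 2) * (1 - s) ^ 2 : ℝ) : ℂ) := by push_cast; ring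
  simp only [Complex.imCLM_apply]
  rw [hpt, hc, Complex.im_ofReal_mul, hreal3, mul_zero]

/-- «The coefficients `a_{μν,κ}` are real»: for a REAL kernel `Π` (`castK P`) with the (5.10)-type bound,
`a_{μν,κ} = (∂_κg_{μν})(1) ∈ ℝ` (`g_{μν}` is real at real points, `B12Rep526Coeff.gRep_im_eq_zero`).
[cite: Balaban1987RG1, (5.30) p.295] -/
theorem im_coeffA_gRep_eq_zero (P : B12Beta.Kernel d) {a M : ℝ} (ha : 0 < a) {μ ν : Fin d}
    (hc : ExpBound a M (castK P μ ν)) (κ : Fin d) : (coeffA (gRep (castK P)) μ ν κ).im = 0 := by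
  have h1 : (fun j => (((fun _ => (1 : ℝ)) : Fin d → ℝ) j : ℂ)) ∈ OpenPolyDisc d a := fun j => by
    simpa using Real.one_lt_exp_iff.mpr ha
  have key := im_pderiv_eq_zero (isOpen_openPolyDisc d a) (analyticOnNhd_gRep hc).differentiableOn
    (fun t _ => gRep_im_eq_zero P μ ν t) κ h1
  unfold coeffA
  simpa using key

/-- «The coefficients `b_{μν,κλ}` are real» (real kernel). [cite: Balaban1987RG1, (5.30) p.295] -/
theorem im_coeffB_gRep_eq_zero (P : B12Beta.Kernel d) {a M : ℝ} (ha : 0 < a) {μ ν : Fin d}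
    (hc : ExpBound a M (castK P μ ν)) (κ l : Fin d) : (coeffB (gRep (castK P)) μ ν κ l).im = 0 := by
  have h1 : (fun j => (((fun _ => (1 : ℝ)) : Fin d → ℝ) j : ℂ)) ∈ OpenPolyDisc d a := fun j => by
    simpa using Real.one_lt_exp_iff.mpr ha
  have key := im_pderiv_pderiv_eq_zero (isOpen_openPolyDisc d a) (analyticOnNhd_gRep hc).differentiableOn
    (fun t _ => gRep_im_eq_zero P μ ν t) κ l h1
  unfold coeffB
  simpa using key

/-- «The functions `g_{μν,κλρ}` are real for real values of `z`» (real kernel; real `z` in the polydisc).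
[cite: Balaban1987RG1, (5.30) p.295] -/
theorem im_rem530_gRep_eq_zero (P : B12Beta.Kernel d) {a M : ℝ} (ha : 0 < a) {μ ν : Fin d}
    (hc : ExpBound a M (castK P μ ν)) (κ l ρ : Fin d) {t : Fin d → ℝ} (ht : (fun j => (t j : ℂ)) ∈ OpenPolyDisc d a) :
    (rem530 (gRep (castK P) μ ν) κ l ρ fun j => (t j : ℂ)).im = 0 :=
  im_rem530_eq_zero ha (analyticOnNhd_gRep hc).differentiableOn (fun t _ => gRep_im_eq_zero P μ ν t) κ l ρ ht

end

/-! ## 7. (v1.2) Kernel witness for the reading note on the remainder weight of (5.30) (GAPS G-B12-04) -/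

section WeightWitness

/-- The one-variable test cubic `w(z) = (z − 1)³` (real variable). [cite: Balaban1987RG1, (5.30) p.295] -/
noncomputable def cubic : ℝ → ℝ := fun z => (z - 1) ^ 3

/-- `w′(x) = 3(x − 1)²`. [cite: Balaban1987RG1, (5.30) p.295] -/
theorem hasDerivAt_cubic (x : ℝ) : HasDerivAt cubic (3 * (x - 1) ^ 2) x := by
  have h1 : HasDerivAt (fun z : ℝ => z - 1) 1 x := (hasDerivAt_id x).sub_const 1
  have h2 : HasDerivAt (fun z : ℝ => (z - 1) ^ 3) (((3 : ℕ) : ℝ) * (x - 1) ^ (3 - 1) * 1) x := h1.pow 3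
  exact h2.congr_deriv (by push_cast; ring)

/-- `w′ = 3(· − 1)²`. [cite: Balaban1987RG1, (5.30) p.295] -/
theorem deriv_cubic : deriv cubic = fun x => 3 * (x - 1) ^ 2 := funext fun x => (hasDerivAt_cubic x).deriv

/-- `(3(x − 1)²)′ = 6(x − 1)`. [cite: Balaban1987RG1, (5.30) p.295] -/
theorem hasDerivAt_cubic' (x : ℝ) : HasDerivAt (fun x : ℝ => 3 * (x - 1) ^ 2) (6 * (x - 1)) x := by
  have h1 : HasDerivAt (fun z : ℝ => z - 1) 1 x := (hasDerivAt_id x).sub_const 1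
  have h2 : HasDerivAt (fun z : ℝ => (z - 1) ^ 2) (((2 : ℕ) : ℝ) * (x - 1) ^ (2 - 1) * 1) x := h1.pow 2
  exact (h2.const_mul (3 : ℝ)).congr_deriv (by push_cast; ring)

/-- `(6(x − 1))′ = 6`. [cite: Balaban1987RG1, (5.30) p.295] -/
theorem hasDerivAt_cubic'' (x : ℝ) : HasDerivAt (fun x : ℝ => 6 * (x - 1)) 6 x := by
  have h1 : HasDerivAt (fun z : ℝ => z - 1) 1 x := (hasDerivAt_id x).sub_const 1
  exact (h1.const_mul (6 : ℝ)).congr_deriv (by ring)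

/-- `w″ = 6(· − 1)`. [cite: Balaban1987RG1, (5.30) p.295] -/
theorem iteratedDeriv_two_cubic : iteratedDeriv 2 cubic = fun x => 6 * (x - 1) := by
  rw [iteratedDeriv_succ, iteratedDeriv_one, deriv_cubic]
  exact funext fun x => (hasDerivAt_cubic' x).deriv

/-- `w‴ ≡ 6`. [cite: Balaban1987RG1, (5.30) p.295] -/
theorem iteratedDeriv_three_cubic : iteratedDeriv 3 cubic = fun _ => (6 : ℝ) := by
  rw [iteratedDeriv_succ, iteratedDeriv_two_cubic]
  exact funext fun x => (hasDerivAt_cubic'' x).deriv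

/-- `∫₀¹ (1 − t)²·6 dt = 2`. [cite: Balaban1987RG1, (5.30) p.295] -/
theorem integral_weight_two : ∫ t in (0:ℝ)..1, (1 - t) ^ 2 * 6 = 2 := by
  have h1 : ∫ t in (0:ℝ)..1, (1 - t) ^ 2 * 6 = 6 * ∫ t in (0:ℝ)..1, (1 - t) ^ 2 := by
    rw [← intervalIntegral.integral_const_mul]
    congr 1; funext t; ring
  have h2 : ∫ t in (0:ℝ)..1, (1 - t) ^ 2 = 1 / 3 := by
    have := intervalIntegral.integral_comp_sub_left (fun t : ℝ => t ^ 2) (1 : ℝ) (a := 0) (b := 1)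
    simp only [sub_self, sub_zero] at this
    rw [this, integral_pow]
    norm_num
  rw [h1, h2]; norm_num

/-- `∫₀¹ (1 − t)·6 dt = 3`. [cite: Balaban1987RG1, (5.30) p.295] -/
theorem integral_weight_one : ∫ t in (0:ℝ)..1, (1 - t) * 6 = 3 := by
  have h1 : ∫ t in (0:ℝ)..1, (1 - t) * 6 = 6 * ∫ t in (0:ℝ)..1, (1 - t) := by
    rw [← intervalIntegral.integral_const_mul]
    congr 1; funext t; ring
  have h2 : ∫ t in (0:ℝ)..1, (1 - t) = 1 / 2 := by
    have := intervalIntegral.integral_comp_sub_left (fun t : ℝ => t) (1 : ℝ) (a := 0) (b := 1)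
    simp only [sub_self, sub_zero] at this
    rw [this, integral_id]
    norm_num
  rw [h1, h2]; norm_num

/-- **The (5.30)-shaped expansion with the weight `½(1 − t)²` is an identity** for the cubic at `z = 2` around `1`:
`w(2) = w(1) + w′(1)(2−1) + ½w″(1)(2−1)² + (2−1)³·½∫₀¹(1 − t)²w‴(1 + t(2−1))dt` (`1 = 0 + 0 + 0 + 1`) — the one-variable
shadow of `eq530`. [cite: Balaban1987RG1, (5.30) p.295] -/
theorem weight_two_holds :
    cubic 2 = cubic 1 + deriv cubic 1 * (2 - 1) + (1 / 2) * iteratedDeriv 2 cubic 1 * (2 - 1) ^ 2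
      + (2 - 1) ^ 3 * ((1 / 2) * ∫ t in (0:ℝ)..1, (1 - t) ^ 2 * iteratedDeriv 3 cubic (1 + t * (2 - 1))) := by
  rw [iteratedDeriv_three_cubic, iteratedDeriv_two_cubic, deriv_cubic]
  simp only [cubic]
  rw [integral_weight_two]
  norm_num

/-- **KERNEL WITNESS (GAPS G-B12-04)**: with the remainder weight `(1 − t)` AS RENDERED in (5.30) (no square) the
display FAILS already for the cubic `(z − 1)³` at `z = 2`: the right-hand side is `(2−1)³·½∫₀¹(1 − t)·6 dt = 3/2 ≠ 1 =
w(2)`.  Located print slip (or scan legibility); the squared weight of `eq530` is the one that holds.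
[cite: Balaban1987RG1, (5.30) p.295] -/
theorem weight_one_fails :
    cubic 2 ≠ cubic 1 + deriv cubic 1 * (2 - 1) + (1 / 2) * iteratedDeriv 2 cubic 1 * (2 - 1) ^ 2
      + (2 - 1) ^ 3 * ((1 / 2) * ∫ t in (0:ℝ)..1, (1 - t) * iteratedDeriv 3 cubic (1 + t * (2 - 1))) := by
  rw [iteratedDeriv_three_cubic, iteratedDeriv_two_cubic, deriv_cubic]
  simp only [cubic]
  rw [integral_weight_one]
  norm_num

end WeightWitness

end Literature.MathematicalPhysics.QuantumFieldTheory.Balaban1983to89.B12Taylor530
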